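import Mathlib
import Literature.Computability.AlgebraicComplexity.AndrewsReduction
import Literature.Computability.AlgebraicComplexity.NonscalarBaurStrassen
import Literature.Computability.AlgebraicComplexity.DeterminantalIdealComplexity
import Literature.Computability.AlgebraicComplexity.DeterminantalIdealComplexityDescent
import Literature.Computability.AlgebraicComplexity.BideterminantReductionProofs
import HarnessLib

/-!
# Andrews 2022, Theorem 3: proof from the Andrews–Forbes reduction (Prop. 3.5)

Topic `Literature/Computability/AlgebraicComplexity`. Proof file for the named fact
`Andrews2022_thm3` of `DeterminantalIdealComplexity.lean` (R. Andrews, *On Matrix Multiplication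
and Polynomial Identity Testing*, FOCS 2022, arXiv:2208.01078, Theorem 3), following the printed
proof (p. 11 of the arXiv text):

> Let `Φ` be a circuit of border multiplicative complexity `s` computing a nonzero polynomial in
> `I^det_{n,m,r}`. Let `X, Y, Z` be `r/4 × r/4` matrices of variables. The polynomial `tr(XYZ)`
> can naturally be computed by a layered trace ABP on `r` vertices. Applying Prop. 2 to `Φ`
> yields a circuit `Ψ` of multiplicative complexity `s` that computes `tr(XYZ) + O(ε)`. We then
> apply Lemma 2 [Baur–Strassen] to obtain a circuit of multiplicative complexity `3s` that
> simultaneously computes all first-order partial derivatives of `tr(XYZ) + O(ε)`. The partial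
> derivative of `tr(XYZ)` with respect to `z_{j,i}` is, up to `O(ε)`, the `(i,j)` entry of `XY`.
> By Lemma 7, the border rank of `r/4 × r/4 × r/4` matrix multiplication is at most `6s`.

with the ingredients formalised in the support files: nonscalar computation sequences and
`L^{ns} ≤ size` (`NonscalarComputation`), Baur–Strassen (`NonscalarBaurStrassen`), Lemma 7
(`NonscalarBilinearRank`, `NonscalarBorderRank`), Lemma 8 (`TraceGadgetMatrix`,
`TraceGadgetTrace`) and Prop. 2 for `tr(XYZ)` (`AndrewsReduction`). Proposition 1 of the paper
is Andrews–Forbes 2022, Prop. 3.5, the tree's named fact `AndrewsForbes2022_prop_3_5`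
(`BideterminantReduction.lean`, universe `0`), discharged in `BideterminantReductionProofs.lean`
(`AndrewsForbes2022_prop_3_5_holds`); accordingly the results here are

* `Andrews2022Proof.Andrews2022_thm3_of_prop35 : AndrewsForbes2022_prop_3_5 → Andrews2022_thm3.{0}`,
* `Andrews2022_thm3_holds : Andrews2022_thm3.{u}` — the DISCHARGE of the named fact, for fields in
  every universe via `Andrews2022_thm3_descent` (`DeterminantalIdealComplexityDescent.lean`).

The remaining ingredients of this file: the bilinear coefficients of `∂ tr(XYZ)/∂z_{νκ}` are the
matrix multiplication tensor `⟨t,t,t⟩` (`coeff_pderiv_traceXYZ`), the corner cases `r < 4`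
(empty tensor, `algBorderRank_matMulTensor_zero`) and `r > min(n,m)` (`detIdeal = ⊥`,
`detIdeal_eq_bot_of_lt`).

## References

* [Andrews2022] R. Andrews, FOCS 2022, arXiv:2208.01078, Thm. 3 and its proof; Lemma 2, Lemma 7,
  Lemma 8, Prop. 1–2.
* [AndrewsForbes2022] R. Andrews, M. A. Forbes, STOC 2022, Prop. 3.5.
* [BaurStrassen1983], [BurgisserClausenShokrollahi1997] (Thm. (7.7), Prop. (14.1)), [Blaser2013]
  (Def. 6.1) — see the support files.
-/

noncomputable section

open MvPolynomial
open scoped RatFunc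

namespace Literature.Computability.AlgebraicComplexity

universe u

namespace Andrews2022Proof

/-! ### The bilinear coefficients of `∂ tr(XYZ) / ∂ z` -/

section Coeff

variable {S : Type u} [CommRing S]

/-- Coefficients of a partial derivative: `coeff_m (∂ᵥ P) = (m v + 1) · coeff_{m + e_v} P`.
[folklore] -/
theorem coeff_pderiv {σ : Type*} (v : σ) (m : σ →₀ ℕ) (P : MvPolynomial σ S) :
    coeff m (pderiv v P) = (m v + 1) • coeff (m + Finsupp.single v 1) P := by
  classical
  induction P using MvPolynomial.induction_on' with
  | monomial d a =>
    rw [pderiv_monomial, coeff_monomial, coeff_monomial]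
    by_cases hd : d = m + Finsupp.single v 1
    · subst hd
      rw [if_pos (add_tsub_cancel_right _ _), if_pos rfl, nsmul_eq_mul, Nat.cast_comm]
      simp
    · rw [if_neg hd, smul_zero]
      split_ifs with h
      · have hdv : d v = 0 := by
          by_contra hne
          apply hd
          ext w
          have := congrArg (fun f : σ →₀ ℕ => f w) h
          simp only [Finsupp.coe_tsub, Pi.sub_apply, Finsupp.single_apply] at this
          simp only [Finsupp.coe_add, Pi.add_apply, Finsupp.single_apply]
          split_ifs at this ⊢ with hw
          · subst hw
            omega
          · omega
        simp [hdv]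
      · rfl
  | add p q hp hq => rw [map_add, coeff_add, coeff_add, hp, hq, smul_add]

/-- A triple sum of the indicator of one point. [folklore] -/
theorem sum_sum_sum_ite_eq {α β γ : Type*} [Fintype α] [Fintype β] [Fintype γ] [DecidableEq α]
    [DecidableEq β] [DecidableEq γ] (a : α) (b : β) (c : γ) {M : Type*} [AddCommMonoid M]
    (x : M) : ∑ i, ∑ j, ∑ k, (if i = a ∧ j = b ∧ k = c then x else 0) = x := by
  rw [Finset.sum_eq_single a, Finset.sum_eq_single b, Finset.sum_eq_single c]
  · simp
  · intro k _ hk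
    simp [hk]
  · simp
  · intro j _ hj
    simp [hj]
  · simp
  · intro i _ hi
    simp [hi]
  · simp

/-- `1 = [P]` forces `P`. [folklore] -/
theorem of_one_eq_ite {P : Prop} [Decidable P] (h : (1 : ℕ) = if P then 1 else 0) : P := by
  by_contra hP
  rw [if_neg hP] at h
  exact one_ne_zero h

open TraceGadget in
/-- **`∂ tr(XYZ)/∂z_{νκ} = (XY)_{κν}` at the level of bilinear coefficients**: the coefficient of
`x_a y_b` in `∂ tr(XYZ)/∂ z_{νκ}` is `1` if `a = (κ, μ)`, `b = (μ, ν)` for some `μ`, and `0`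
otherwise — the matrix multiplication tensor `⟨t,t,t⟩` in the coordinates of `matMulTensor`.
[cite: Andrews2022, Thm. 3 (proof)] -/
theorem coeff_pderiv_traceXYZ (t : ℕ) (κ ν : Fin t) (a b : Fin t × Fin t) :
    coeff (Finsupp.single (Sum.inl a) 1 + Finsupp.single (Sum.inr (Sum.inl b)) 1)
        (pderiv (Sum.inr (Sum.inr (ν, κ))) (traceXYZ S t)) =
      if κ = a.1 ∧ a.2 = b.1 ∧ ν = b.2 then 1 else 0 := by
  classical
  obtain ⟨a1, a2⟩ := a
  obtain ⟨b1, b2⟩ := b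
  simp only
  set v : Var t := Sum.inr (Sum.inr (ν, κ)) with hv
  set m : Var t →₀ ℕ := Finsupp.single (Sum.inl (a1, a2)) 1 +
    Finsupp.single (Sum.inr (Sum.inl (b1, b2))) 1 with hm
  have hmv : m v = 0 := by simp [hm, hv]
  rw [coeff_pderiv, hmv, zero_add, one_smul]
  -- `tr(XYZ)` as a sum of monomials
  have hT : (traceXYZ S t : MvPolynomial (Var t) S) = ∑ i : Fin t, ∑ μ : Fin t, ∑ ν' : Fin t,
      monomial (Finsupp.single (Sum.inl (i, μ)) 1 + Finsupp.single (Sum.inr (Sum.inl (μ, ν'))) 1 +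
        Finsupp.single (Sum.inr (Sum.inr (ν', i))) 1) 1 := by
    simp only [traceXYZ, diagXYZ, X, monomial_mul, mul_one]
  rw [hT]
  simp only [coeff_sum, coeff_monomial]
  -- the exponent equation pins down `(i, μ, ν')`
  have key : ∀ (i μ ν' : Fin t),
      (Finsupp.single (Sum.inl (i, μ)) 1 + Finsupp.single (Sum.inr (Sum.inl (μ, ν'))) 1 +
          Finsupp.single (Sum.inr (Sum.inr (ν', i))) 1 = m + Finsupp.single v 1) ↔
        (i = κ ∧ μ = a2 ∧ ν' = ν) ∧ (κ = a1 ∧ a2 = b1 ∧ ν = b2) := by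
    intro i μ ν'
    constructor
    · intro h
      have h1 := congrArg (fun f : Var t →₀ ℕ => f (Sum.inl (i, μ))) h
      have h2 := congrArg (fun f : Var t →₀ ℕ => f (Sum.inr (Sum.inl (μ, ν')))) h
      have h3 := congrArg (fun f : Var t →₀ ℕ => f (Sum.inr (Sum.inr (ν', i)))) h
      simp only [hm, hv, Finsupp.coe_add, Pi.add_apply, Finsupp.single_apply, Sum.inl.injEq,
        Sum.inr.injEq, reduceCtorEq, if_true, if_false, add_zero, zero_add] at h1 h2 h3
      obtain ⟨rfl, rfl⟩ := Prod.mk.injEq _ _ _ _ ▸ of_one_eq_ite h1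
      obtain ⟨rfl, rfl⟩ := Prod.mk.injEq _ _ _ _ ▸ of_one_eq_ite h2
      obtain ⟨rfl, rfl⟩ := Prod.mk.injEq _ _ _ _ ▸ of_one_eq_ite h3
      simp
    · rintro ⟨⟨rfl, rfl, rfl⟩, rfl, rfl, rfl⟩
      rw [hm, hv]
  simp_rw [key]
  by_cases hc : κ = a1 ∧ a2 = b1 ∧ ν = b2
  · obtain ⟨rfl, rfl, rfl⟩ := hc
    simp only [and_self, and_true, if_true]
    exact sum_sum_sum_ite_eq κ a2 ν (1 : S)
  · simp [hc]

end Coeff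

/-! ### Corner cases -/

/-- For `t = 0` the matrix multiplication tensor is empty and has border rank `0`. [folklore] -/
theorem algBorderRank_matMulTensor_zero (K : Type u) [Field K] :
    algBorderRank (matMulTensor K 0 0 0) = 0 := by
  have h : tensorRank (matMulTensor K 0 0 0) ≤ 0 :=
    tensorRank_le_of_eq_sum Fin.elim0 Fin.elim0 Fin.elim0 (by
      funext a
      exact a.1.elim0)
  exact Nat.le_zero.1 ((algBorderRank_le_tensorRank _).trans h)

/-- Minors larger than the number of rows vanish. [folklore] -/
theorem detIdeal_eq_bot_of_lt_rows (K : Type u) [Field K] {n m r : ℕ} (hn : n < r) :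
    detIdeal K n m r = ⊥ := by
  classical
  rw [detIdeal, Ideal.span_eq_bot]
  rintro p ⟨ρ, γ, rfl⟩
  have hρ : ¬Function.Injective ρ := fun hi => by
    have := Fintype.card_le_of_injective ρ hi
    simp only [Fintype.card_fin] at this
    omega
  obtain ⟨i, j, hij, hne⟩ := Function.not_injective_iff.1 hρ
  exact Matrix.det_zero_of_row_eq hne (by
    ext k
    simp [Matrix.submatrix_apply, hij])

/-- Minors larger than the number of columns vanish. [folklore] -/
theorem detIdeal_eq_bot_of_lt_cols (K : Type u) [Field K] {n m r : ℕ} (hm : m < r) :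
    detIdeal K n m r = ⊥ := by
  classical
  rw [detIdeal, Ideal.span_eq_bot]
  rintro p ⟨ρ, γ, rfl⟩
  have hγ : ¬Function.Injective γ := fun hi => by
    have := Fintype.card_le_of_injective γ hi
    simp only [Fintype.card_fin] at this
    omega
  obtain ⟨i, j, hij, hne⟩ := Function.not_injective_iff.1 hγ
  rw [← Matrix.det_transpose]
  exact Matrix.det_zero_of_row_eq hne (by
    ext k
    simp [Matrix.submatrix_apply, hij])

/-- Minors larger than the matrix vanish: `I^det_{n,m,r} = 0` for `r > min(n, m)`. [folklore] -/
theorem detIdeal_eq_bot_of_lt (K : Type u) [Field K] {n m r : ℕ} (h : min n m < r) :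
    detIdeal K n m r = ⊥ := by
  rcases min_lt_iff.1 h with hn | hm
  · exact detIdeal_eq_bot_of_lt_rows K hn
  · exact detIdeal_eq_bot_of_lt_cols K hm

/-! ### The main case `4 ≤ r ≤ min(n, m)` -/

open TraceGadget in
/-- **Theorem 3, main case, from the data of Prop. 3.5.** For `f` admitting the conclusion of
Andrews–Forbes Prop. 3.5 with `σ`-parts `≤ min(n,m)` and `#{s ∈ σ : 3t+i < s} ≥ 1` (`i < t`),
`bR(⟨t,t,t⟩) ≤ 6 · complexity f`: Prop. 2 for `tr(XYZ)` (`exists_seq_traceXYZ`), Baur–Strassen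
(`exists_isNonscalarSeq_forall_pderiv`), the identification of the bilinear coefficients of
`∂ tr(XYZ)/∂z` with `⟨t,t,t⟩` (`coeff_pderiv_traceXYZ`) and Lemma 7
(`algBorderRank_le_of_isNonscalarSeq_laurent`). [cite: Andrews2022, Thm. 3 (proof)] -/
theorem algBorderRank_le_of_prop35_data {F : Type} [Field F] [CharZero F] {n m : ℕ}
    (f : MvPolynomial (Fin n × Fin m) F)
    (c : Matrix (Fin n × Fin m) (Fin n × Fin m) (RatFunc F)) (q : ℤ) {α : F} (hα : α ≠ 0)
    (σ : Multiset ℕ) (hσ : ∀ s ∈ σ, s ≤ n ∧ s ≤ m) (t : ℕ) [NeZero t]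
    (hN : ∀ i : Fin t, 0 < (σ.filter fun s => (i : ℕ) + 3 * t < s).card)
    (h : ∀ e : (Fin n × Fin m) →₀ ℕ, IsBigOEps F (q + 1) (coeff e
      (aeval (fun ij : Fin n × Fin m => ∑ kl : Fin n × Fin m, C (c ij kl) * X kl) f -
        C (RatFunc.X ^ q * algebraMap F (RatFunc F) α) *
          MvPolynomial.map (algebraMap F (RatFunc F)) (kBideterminant F n m σ)))) :
    algBorderRank (matMulTensor F t t t) ≤ 6 * complexity f := by
  classical
  obtain ⟨gs, hgs, hlen, E, hE, hmem⟩ := exists_seq_traceXYZ f c q hα σ hσ t hN h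
  -- Baur–Strassen
  obtain ⟨gs', hgs', hlen', hder⟩ := exists_isNonscalarSeq_forall_pderiv
    (s := complexity f) ⟨gs, hgs, hlen, hmem⟩
  -- Lemma 7 applied to the partial derivatives with respect to the `z`-variables
  have hbound := algBorderRank_le_of_isNonscalarSeq_laurent (F := F) (σ := Var t)
    (Sum.inl : Fin t × Fin t → Var t) (fun b : Fin t × Fin t => Sum.inr (Sum.inl b))
    (fun _ _ => Sum.inl_ne_inr) (N := 3 * complexity f)
    (fun o : Fin t × Fin t => pderiv (Sum.inr (Sum.inr (o.2, o.1)))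
      (traceXYZ (LaurentSeries F) t + E))
    (matMulTensor F t t t) ⟨gs', hgs', hlen', fun o => hder _⟩ ?_
  · omega
  intro o a b
  rw [map_add, coeff_add, coeff_pderiv_traceXYZ, matMulTensor]
  have hC : (HahnSeries.C (if o.1 = a.1 ∧ a.2 = b.1 ∧ o.2 = b.2 then (1 : F) else 0) :
      LaurentSeries F) = if o.1 = a.1 ∧ a.2 = b.1 ∧ o.2 = b.2 then 1 else 0 := by
    split_ifs <;> simp
  rw [hC, add_sub_cancel_left]
  exact (hE.pderiv _) _

/-- **Andrews 2022, Theorem 3, from Andrews–Forbes 2022, Prop. 3.5.** For every field `F` of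
characteristic zero (in universe `0`, the universe of the tree's `AndrewsForbes2022_prop_3_5`),
all `n m r` and every nonzero `f ∈ I^det_{n,m,r}`:
`bR(⟨⌊r/4⌋,⌊r/4⌋,⌊r/4⌋⟩) ≤ 6 · complexity(f)`. Corner cases: for `r < 4` the tensor is empty;
for `r > min(n,m)` the ideal is `0`. In the main case Prop. 3.5 supplies `c, q, α, σ` with
`max σ ≥ r ≥ 4⌊r/4⌋`, so every count `#{s ∈ σ : 3t + i < s}` (`t = ⌊r/4⌋`, `i < t`) is positive
and `algBorderRank_le_of_prop35_data` applies. [cite: Andrews2022, Thm. 3] -/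
theorem Andrews2022_thm3_of_prop35 (hAF : AndrewsForbes2022_prop_3_5) : Andrews2022_thm3.{0} := by
  intro F _ _ n m r f hf hf0
  -- corner case `r < 4`
  by_cases hr4 : r < 4
  · have ht0 : r / 4 = 0 := Nat.div_eq_of_lt hr4
    rw [ht0, algBorderRank_matMulTensor_zero]
    exact Nat.zero_le _
  -- corner case `r > min n m`
  by_cases hmin : min n m < r
  · exfalso
    rw [detIdeal_eq_bot_of_lt F hmin, Ideal.mem_bot] at hf
    exact hf0 hf
  push Not at hr4 hmin
  -- main case
  set t := r / 4 with ht
  have htpos : 0 < t := Nat.div_pos hr4 (by norm_num)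
  haveI : NeZero t := ⟨htpos.ne'⟩
  obtain ⟨c, q, α, σ, -, hα, hsup, hσ, hcoef⟩ := hAF F n m r (by omega) hmin f hf hf0
  have hσ' : ∀ s ∈ σ, s ≤ n ∧ s ≤ m := fun s hs => le_min_iff.1 (hσ s hs).2
  have h4t : 4 * t ≤ r := by
    rw [ht]
    exact Nat.mul_div_le r 4
  have hbig : ∃ s ∈ σ, 4 * t ≤ s := by
    by_contra hcon
    push Not at hcon
    have : σ.sup ≤ 4 * t - 1 :=
      Multiset.sup_le.2 fun s hs => Nat.le_sub_one_of_lt (hcon s hs)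
    omega
  have hN : ∀ i : Fin t, 0 < (σ.filter fun s => (i : ℕ) + 3 * t < s).card := by
    intro i
    obtain ⟨s, hs, h4s⟩ := hbig
    exact Multiset.card_pos_iff_exists_mem.2 ⟨s, Multiset.mem_filter.2 ⟨hs, by omega⟩⟩
  exact algBorderRank_le_of_prop35_data f c q hα σ hσ' t hN hcoef

end Andrews2022Proof

/-- **Andrews 2022, Theorem 3 — discharge of the named fact `Andrews2022_thm3`.** For every field
`F` of characteristic zero (any universe), all `n m r` and every nonzero `f ∈ I^det_{n,m,r}`:
`bR(⟨⌊r/4⌋,⌊r/4⌋,⌊r/4⌋⟩) ≤ 6 · complexity(f)`. Proof: `Andrews2022_thm3_of_prop35` (the printed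
proof: Prop. 1 = Andrews–Forbes Prop. 3.5, Lemma 8, Prop. 2, Baur–Strassen, Lemma 7) applied to
`AndrewsForbes2022_prop_3_5_holds`, transported to all universes by `Andrews2022_thm3_descent`.
[cite: Andrews2022, Thm. 3] -/
theorem Andrews2022_thm3_holds : Andrews2022_thm3.{u} :=
  Andrews2022_thm3_descent
    (Andrews2022Proof.Andrews2022_thm3_of_prop35 AndrewsForbes2022_prop_3_5_holds)

end Literature.Computability.AlgebraicComplexity
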